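import Literature.Combinatorics.Optimization.CompletelyPsdRank
import HarnessLib

/-!
# The normal form `Σ_i A_i = Σ_j B_j` of a psd factorization (PSVW §3.3.2)

Source: A. Prakash, J. Sikora, A. Varvitsiotis, Z. Wei, *Completely positive semidefinite rank*,
Math. Program. 171 (2018) 397–431 = arXiv:1604.07199 [PrakashEtAl2017], §3.3.2 "cpsd-rank vs.
psd-rank" (held text `paper:arxiv-1604.07199`, chunk p12), last paragraph, verbatim:

"In turn, this [`psd-rank(X)`] is equal to the smallest integer `d ≥ 1` for which there exist Hermitian
psd matrices `{A_i}_{i=1}^n, {B_j}_{j=1}^m ⊆ H^d_+` such that `X_{ij} = tr(A_iB_j)`, for all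
`i ∈ [n], j ∈ [m]` and `Σ_{i=1}^n A_i = Σ_{j=1}^m B_j`. As a corollary we also get that in any
psd-factorization of `X` we may assume that the psd factors satisfy `Σ_{i=1}^n A_i = Σ_{j=1}^m B_j`."

`CompletelyPsdRank.lean` lists "§3.3.2's normal form `Σ A_i = Σ B_j` (a statement about
Hermitian-factor psd rank)" among the statements NOT typed. It is typed and PROVED here for the psd
factorizations of the tree (`HasPsdFactorization`, real symmetric psd factors — the psd rank of
Fawzi–Gouveia–Parrilo–Robinson–Thomas used throughout this directory; PSVW state it for Hermitian
factors, whose proof is the same computation over `ℂ` and is not typed):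

* `exists_sum_eq_of_posDef` — the heart: if `A = Σ A_i` and `B = Σ B_j` are positive DEFINITE, the
  factorization `A'_i = N A_i N`, `B'_j = N⁻¹ B_j N⁻¹` with `N = M^{1/2}`, `M = A^{-1/2}(A^{1/2} B
  A^{1/2})^{1/2}A^{-1/2}` (the matrix geometric mean `A⁻¹ # B`, the positive solution of `MAM = B`) has
  the same size, the same inner products `tr(A'_iB'_j) = tr(A_iB_j)` and `Σ A'_i = Σ B'_j`;
* `exists_sum_eq` — in general: compress first to the support of `Σ A_i`, then to the support of the
  compressed `Σ B_j` (inner products are unchanged because every `A_i` — resp. `B_j` — lives on that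
  support), which makes both sums definite, of some size `d' ≤ d`;
* `HasPsdFactorization.exists_sum_eq` — **the printed corollary** for the tree's psd factorizations:
  every `M` with a psd factorization of size `k` has one of size `k` whose factors satisfy
  `Σ_i A_i = Σ_j B_j` (pad the balanced factorization of size `d' ≤ k` by zero blocks).

The printed route goes through Jain–Shi–Wei–Zhang's identification `𝒟(p) = psd-rank(X)` and PSVW
Theorem 1; the proof here is a different, elementary one (Riccati equation / geometric mean), recorded
as such. No facts are introduced.
-/

noncomputable section

open Matrix Finset
open scoped MatrixOrder

namespace Literature.Combinatorics.Optimization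

namespace PsdSumNormalForm

/-! ### Compression of real symmetric matrices to a subspace -/

section Compression

variable {d m : ℕ} {K : Submodule ℝ (EuclideanSpace ℝ (Fin d))}

/-- The `d × m` matrix of an orthonormal basis of a subspace `K ⊆ ℝ^d`. [folklore] -/
private def onbMat (b : OrthonormalBasis (Fin m) ℝ K) : Matrix (Fin d) (Fin m) ℝ :=
  Matrix.of fun s a => (b a : EuclideanSpace ℝ (Fin d)) s

/-- `QᵀQ = I`. [folklore] -/
private theorem onbMat_transpose_mul_self (b : OrthonormalBasis (Fin m) ℝ K) :
    (onbMat b)ᵀ * onbMat b = 1 := by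
  ext a c
  have h := orthonormal_iff_ite.mp b.orthonormal a c
  rw [Submodule.coe_inner] at h
  have h' : ∑ s, (b a : EuclideanSpace ℝ (Fin d)) s * (b c : EuclideanSpace ℝ (Fin d)) s =
      if a = c then 1 else 0 := by
    simpa [PiLp.inner_apply, mul_comm] using h
  rw [Matrix.mul_apply, Matrix.one_apply, ← h']
  simp only [onbMat, transpose_apply, of_apply]

/-- `Q z`, as a vector of `ℝ^d`, is `Σ_a z_a b_a ∈ K`. [folklore] -/
private theorem toLp_onbMat_mulVec_mem (b : OrthonormalBasis (Fin m) ℝ K) (z : Fin m → ℝ) :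
    WithLp.toLp 2 (onbMat b *ᵥ z) ∈ K := by
  have h : WithLp.toLp 2 (onbMat b *ᵥ z) = ∑ a, z a • (b a : EuclideanSpace ℝ (Fin d)) := by
    apply WithLp.ofLp_injective 2
    rw [WithLp.ofLp_toLp, WithLp.ofLp_sum]
    funext s
    simp only [mulVec, dotProduct, onbMat, of_apply, Finset.sum_apply, WithLp.ofLp_smul,
      Pi.smul_apply, smul_eq_mul]
    exact Finset.sum_congr rfl fun a _ => mul_comm _ _
  rw [h]
  exact Submodule.sum_mem _ fun a _ => Submodule.smul_mem _ _ (b a).2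

/-- `Q Qᵀ v = v` for `v ∈ K`. [folklore] -/
private theorem onbMat_proj_mulVec (b : OrthonormalBasis (Fin m) ℝ K)
    {v : EuclideanSpace ℝ (Fin d)} (hv : v ∈ K) :
    (onbMat b * (onbMat b)ᵀ) *ᵥ v.ofLp = v.ofLp := by
  classical
  funext s
  have h := b.sum_repr' ⟨v, hv⟩
  have h2 := congrArg (fun w : K => (w : EuclideanSpace ℝ (Fin d)) s) h
  simp only [Submodule.coe_sum, Submodule.coe_smul, Submodule.coe_inner] at h2
  have h3 : ∑ a, (inner ℝ (b a : EuclideanSpace ℝ (Fin d)) v) *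
      (b a : EuclideanSpace ℝ (Fin d)) s = v s := by
    simpa [WithLp.ofLp_sum, Finset.sum_apply, smul_eq_mul] using h2
  rw [← mulVec_mulVec]
  change _ = v s
  rw [← h3]
  simp only [mulVec, dotProduct, onbMat, transpose_apply, of_apply]
  refine sum_congr rfl fun a _ => ?_
  rw [mul_comm]
  congr 1
  simp [PiLp.inner_apply, mul_comm]

/-- `Q Qᵀ A = A` when the columns of `A` lie in `K`. [folklore] -/
private theorem onbMat_proj_mul (b : OrthonormalBasis (Fin m) ℝ K) {A : Matrix (Fin d) (Fin d) ℝ}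
    (hrange : ∀ w : Fin d → ℝ, WithLp.toLp 2 (A *ᵥ w) ∈ K) :
    onbMat b * (onbMat b)ᵀ * A = A := by
  classical
  ext s t
  have h := congrFun (onbMat_proj_mulVec b (hrange (Pi.single t 1))) s
  simp only [mulVec_mulVec] at h
  simpa [Matrix.mulVec_single_one] using h

/-- Compression to `K`: `Tr(QᵀAQ · QᵀBQ) = Tr(A B)` for symmetric `A` with columns in `K`. [folklore] -/
private theorem trace_compress (b : OrthonormalBasis (Fin m) ℝ K) {A B : Matrix (Fin d) (Fin d) ℝ}
    (hA : Aᵀ = A) (hrange : ∀ w : Fin d → ℝ, WithLp.toLp 2 (A *ᵥ w) ∈ K) :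
    ((onbMat b)ᵀ * A * onbMat b * ((onbMat b)ᵀ * B * onbMat b)).trace = (A * B).trace := by
  set Q := onbMat b with hQ
  have hPA : Q * Qᵀ * A = A := onbMat_proj_mul b hrange
  have hAP : A * (Q * Qᵀ) = A := by
    have h := congrArg transpose hPA
    rw [transpose_mul, transpose_mul, transpose_transpose, hA] at h
    exact h
  calc (Qᵀ * A * Q * (Qᵀ * B * Q)).trace = ((Qᵀ * A * Q * Qᵀ * B) * Q).trace := by
        simp only [Matrix.mul_assoc]
    _ = (Q * (Qᵀ * A * Q * Qᵀ * B)).trace := Matrix.trace_mul_comm _ _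
    _ = ((Q * Qᵀ * A) * (Q * Qᵀ) * B).trace := by simp only [Matrix.mul_assoc]
    _ = (A * B).trace := by rw [hPA, hAP]

end Compression

/-! ### Kernels of sums of psd matrices -/

section Kernel

variable {d : ℕ} {ι : Type*} [Fintype ι]

/-- A kernel vector of a sum of psd matrices is a kernel vector of each summand. [folklore] -/
private theorem mulVec_eq_zero_of_sum_mulVec_eq_zero {A : ι → Matrix (Fin d) (Fin d) ℝ}
    (hA : ∀ i, (A i).PosSemidef) {v : Fin d → ℝ} (hv : (∑ i, A i) *ᵥ v = 0) (i : ι) :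
    A i *ᵥ v = 0 := by
  have hnn : ∀ i, 0 ≤ star v ⬝ᵥ (A i *ᵥ v) := fun i => (hA i).dotProduct_mulVec_nonneg v
  have hsum : ∑ i, star v ⬝ᵥ (A i *ᵥ v) = 0 := by
    rw [← dotProduct_sum, ← Matrix.sum_mulVec, hv, dotProduct_zero]
  have h0 := (Finset.sum_eq_zero_iff_of_nonneg fun i _ => hnn i).mp hsum i (Finset.mem_univ i)
  exact ((hA i).dotProduct_mulVec_zero_iff v).mp h0

/-- The kernel of a symmetric matrix `A` as a subspace of `ℝ^d`. [folklore] -/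
private def kerSub (A : Matrix (Fin d) (Fin d) ℝ) : Submodule ℝ (EuclideanSpace ℝ (Fin d)) where
  carrier := {v | A *ᵥ v.ofLp = 0}
  add_mem' := fun {u v} hu hv => by
    simp only [Set.mem_setOf_eq] at hu hv ⊢
    rw [WithLp.ofLp_add, mulVec_add, hu, hv, add_zero]
  zero_mem' := by simp
  smul_mem' := fun c v hv => by
    simp only [Set.mem_setOf_eq] at hv ⊢
    rw [WithLp.ofLp_smul, mulVec_smul, hv, smul_zero]

/-- Membership in `kerSub A`. [folklore] -/
private theorem mem_kerSub {A : Matrix (Fin d) (Fin d) ℝ} {v : EuclideanSpace ℝ (Fin d)} :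
    v ∈ kerSub A ↔ A *ᵥ v.ofLp = 0 := Iff.rfl

/-- The columns of a symmetric `B` with `ker A ⊆ ker B` lie in `(ker A)ᗮ`. [folklore] -/
private theorem toLp_mulVec_mem_orthogonal {A B : Matrix (Fin d) (Fin d) ℝ} (hB : Bᵀ = B)
    (hker : ∀ v : Fin d → ℝ, A *ᵥ v = 0 → B *ᵥ v = 0) (w : Fin d → ℝ) :
    WithLp.toLp 2 (B *ᵥ w) ∈ (kerSub A)ᗮ := by
  rw [Submodule.mem_orthogonal]
  intro u hu
  have hu' : B *ᵥ u.ofLp = 0 := hker _ (mem_kerSub.mp hu)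
  have hinner : inner ℝ u (WithLp.toLp 2 (B *ᵥ w)) = u.ofLp ⬝ᵥ (B *ᵥ w) := by
    simp [PiLp.inner_apply, dotProduct, mul_comm]
  rw [hinner, dotProduct_mulVec, ← hB, vecMul_transpose, hu', zero_dotProduct]

end Kernel

/-! ### One compression step -/

section Step

variable {d : ℕ} {ι κ : Type*} [Fintype ι] [Fintype κ]

/-- **Compression to the support of `Σ A_i`.** Real symmetric psd `A_i, B_j` of size `d` can be
replaced by psd `A°_i, B°_j` of some size `m ≤ d` with the same inner products `tr(A°_iB°_j) =
tr(A_iB_j)`, with `Σ A°_i` positive DEFINITE, and with `Σ B°_j` positive definite if `Σ B_j` was.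
(Compress by an orthonormal basis `Q` of `(ker Σ A_i)ᗮ`: `Z ↦ QᵀZQ`; every `A_i` lives on that
support since `ker Σ A_i ⊆ ker A_i`.) [folklore] -/
private theorem compress_step (A : ι → Matrix (Fin d) (Fin d) ℝ) (B : κ → Matrix (Fin d) (Fin d) ℝ)
    (hA : ∀ i, (A i).PosSemidef) (hB : ∀ j, (B j).PosSemidef) :
    ∃ (m : ℕ) (A' : ι → Matrix (Fin m) (Fin m) ℝ) (B' : κ → Matrix (Fin m) (Fin m) ℝ),
      m ≤ d ∧ (∀ i, (A' i).PosSemidef) ∧ (∀ j, (B' j).PosSemidef) ∧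
      (∀ i j, (A' i * B' j).trace = (A i * B j).trace) ∧ (∑ i, A' i).PosDef ∧
      ((∑ j, B j).PosDef → (∑ j, B' j).PosDef) := by
  classical
  set S := ∑ i, A i with hS
  have hSpsd : S.PosSemidef := posSemidef_sum Finset.univ fun i _ => hA i
  have hAsymm : ∀ i, (A i)ᵀ = A i := fun i => by
    have h := (hA i).1.eq
    rwa [conjTranspose_eq_transpose_of_trivial] at h
  let G := kerSub S
  let b := stdOrthonormalBasis ℝ Gᗮ
  set m := Module.finrank ℝ Gᗮ with hm
  set Q := onbMat b with hQ
  have hQQ : Qᵀ * Q = 1 := onbMat_transpose_mul_self b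
  have hArange : ∀ i (w : Fin d → ℝ), WithLp.toLp 2 (A i *ᵥ w) ∈ Gᗮ := fun i w =>
    toLp_mulVec_mem_orthogonal (hAsymm i) (fun v hv => mulVec_eq_zero_of_sum_mulVec_eq_zero hA hv i) w
  have hmd : m ≤ d := by
    have h := Submodule.finrank_le (Gᗮ)
    rw [finrank_euclideanSpace, Fintype.card_fin] at h
    exact h
  refine ⟨m, fun i => Qᵀ * A i * Q, fun j => Qᵀ * B j * Q, hmd, fun i => ?_, fun j => ?_,
    fun i j => ?_, ?_, fun hBdef => ?_⟩
  · have h := (hA i).conjTranspose_mul_mul_same Q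
    rwa [conjTranspose_eq_transpose_of_trivial] at h
  · have h := (hB j).conjTranspose_mul_mul_same Q
    rwa [conjTranspose_eq_transpose_of_trivial] at h
  · exact trace_compress b (hAsymm i) (hArange i)
  · -- `Qᵀ S Q` is positive definite
    have hsum : ∑ i, Qᵀ * A i * Q = Qᵀ * S * Q := by
      rw [hS, Matrix.mul_sum, Matrix.sum_mul]
    rw [hsum, Matrix.posDef_iff_dotProduct_mulVec]
    have hpsd : (Qᵀ * S * Q).PosSemidef := by
      have h := hSpsd.conjTranspose_mul_mul_same Q
      rwa [conjTranspose_eq_transpose_of_trivial] at h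
    refine ⟨hpsd.1, fun z hz => ?_⟩
    have hform : star z ⬝ᵥ ((Qᵀ * S * Q) *ᵥ z) = star (Q *ᵥ z) ⬝ᵥ (S *ᵥ (Q *ᵥ z)) := by
      rw [star_trivial, star_trivial, ← mulVec_mulVec, ← mulVec_mulVec, dotProduct_mulVec,
        vecMul_transpose]
    rw [hform]
    have hnn := hSpsd.dotProduct_mulVec_nonneg (Q *ᵥ z)
    rcases hnn.lt_or_eq with h | h
    · exact h
    · exfalso
      -- `S (Qz) = 0`, so `Qz ∈ G ∩ Gᗮ = 0`, so `z = QᵀQ z = 0`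
      have hker : S *ᵥ (Q *ᵥ z) = 0 := (hSpsd.dotProduct_mulVec_zero_iff _).mp h.symm
      have hmemG : WithLp.toLp 2 (Q *ᵥ z) ∈ G := by
        rw [mem_kerSub, WithLp.ofLp_toLp]
        exact hker
      have hmemG' : WithLp.toLp 2 (Q *ᵥ z) ∈ Gᗮ := toLp_onbMat_mulVec_mem b z
      have hzero : WithLp.toLp 2 (Q *ᵥ z) = 0 := by
        have h0 := (Submodule.mem_orthogonal G _).mp hmemG' _ hmemG
        exact inner_self_eq_zero.mp h0
      have hQz : Q *ᵥ z = 0 := by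
        have := congrArg (WithLp.ofLp) hzero
        rwa [WithLp.ofLp_toLp, WithLp.ofLp_zero] at this
      apply hz
      calc z = (Qᵀ * Q) *ᵥ z := by rw [hQQ, one_mulVec]
        _ = 0 := by rw [← mulVec_mulVec, hQz, mulVec_zero]
  · -- definiteness of `Σ B_j` is preserved (`Q` is injective)
    have hsum : ∑ j, Qᵀ * B j * Q = Qᵀ * (∑ j, B j) * Q := by
      rw [Matrix.mul_sum, Matrix.sum_mul]
    rw [hsum, Matrix.posDef_iff_dotProduct_mulVec]
    have hpsd : (Qᵀ * (∑ j, B j) * Q).PosSemidef := by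
      have h := hBdef.posSemidef.conjTranspose_mul_mul_same Q
      rwa [conjTranspose_eq_transpose_of_trivial] at h
    refine ⟨hpsd.1, fun z hz => ?_⟩
    have hform : star z ⬝ᵥ ((Qᵀ * (∑ j, B j) * Q) *ᵥ z) =
        star (Q *ᵥ z) ⬝ᵥ ((∑ j, B j) *ᵥ (Q *ᵥ z)) := by
      rw [star_trivial, star_trivial, ← mulVec_mulVec, ← mulVec_mulVec, dotProduct_mulVec,
        vecMul_transpose]
    rw [hform]
    have hQz : Q *ᵥ z ≠ 0 := by
      intro h0
      apply hz
      calc z = (Qᵀ * Q) *ᵥ z := by rw [hQQ, one_mulVec]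
        _ = 0 := by rw [← mulVec_mulVec, h0, mulVec_zero]
    exact (Matrix.posDef_iff_dotProduct_mulVec.mp hBdef).2 hQz

end Step

/-! ### The definite case: the geometric mean -/

section Definite

variable {d : ℕ} {ι κ : Type*} [Fintype ι] [Fintype κ]

/-- Square roots of real psd matrices: `√A √A = A`, `√A` symmetric psd. [folklore] -/
private theorem sqrt_spec {A : Matrix (Fin d) (Fin d) ℝ} (hA : A.PosSemidef) :
    CFC.sqrt A * CFC.sqrt A = A ∧ (CFC.sqrt A).PosSemidef ∧ (CFC.sqrt A)ᵀ = CFC.sqrt A := by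
  have h1 : CFC.sqrt A * CFC.sqrt A = A := CFC.sqrt_mul_sqrt_self A hA.nonneg
  have h2 : (CFC.sqrt A).PosSemidef := (CFC.sqrt_nonneg A).posSemidef
  refine ⟨h1, h2, ?_⟩
  have h := h2.1.eq
  rwa [conjTranspose_eq_transpose_of_trivial] at h

/-- If `S S = A` with `det A ≠ 0` then `det S ≠ 0`. [folklore] -/
private theorem isUnit_det_of_mul_self {S A : Matrix (Fin d) (Fin d) ℝ} (h : S * S = A)
    (hA : A.det ≠ 0) : IsUnit S.det := by
  rw [isUnit_iff_ne_zero]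
  intro h0
  apply hA
  rw [← h, det_mul, h0, mul_zero]

/-- **The definite case.** If `Σ A_i` and `Σ B_j` are positive definite, there are psd `A'_i, B'_j` of
the same size with `tr(A'_iB'_j) = tr(A_iB_j)` and `Σ A'_i = Σ B'_j`: with `S = A^{1/2}`,
`R = (SBS)^{1/2}`, `M = S⁻¹RS⁻¹` (so that `MAM = B`) and `N = M^{1/2}`, take `A'_i = N A_i N`,
`B'_j = N⁻¹ B_j N⁻¹`. [cite: PrakashEtAl2017, §3.3.2 (p12)] -/
theorem exists_sum_eq_of_posDef (A : ι → Matrix (Fin d) (Fin d) ℝ) (B : κ → Matrix (Fin d) (Fin d) ℝ)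
    (hA : ∀ i, (A i).PosSemidef) (hB : ∀ j, (B j).PosSemidef) (hAd : (∑ i, A i).PosDef)
    (hBd : (∑ j, B j).PosDef) :
    ∃ (A' : ι → Matrix (Fin d) (Fin d) ℝ) (B' : κ → Matrix (Fin d) (Fin d) ℝ),
      (∀ i, (A' i).PosSemidef) ∧ (∀ j, (B' j).PosSemidef) ∧
      (∀ i j, (A' i * B' j).trace = (A i * B j).trace) ∧ ∑ i, A' i = ∑ j, B' j := by
  classical
  set Asum := ∑ i, A i with hAsum
  set Bsum := ∑ j, B j with hBsum
  -- `S = A^{1/2}`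
  obtain ⟨hSS, hSpsd, hSt⟩ := sqrt_spec hAd.posSemidef
  set S := CFC.sqrt Asum with hSdef
  have hSu : IsUnit S.det := isUnit_det_of_mul_self hSS hAd.det_pos.ne'
  have hSinv : S * S⁻¹ = 1 := Matrix.mul_nonsing_inv S hSu
  have hSinv' : S⁻¹ * S = 1 := Matrix.nonsing_inv_mul S hSu
  have hSit : (S⁻¹)ᵀ = S⁻¹ := by rw [transpose_nonsing_inv, hSt]
  -- `C = S B S`, `R = C^{1/2}`
  set C := S * Bsum * S with hCdef
  have hCpsd : C.PosSemidef := by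
    have h := hBd.posSemidef.conjTranspose_mul_mul_same S
    rwa [conjTranspose_eq_transpose_of_trivial, hSt] at h
  have hCdet : C.det ≠ 0 := by
    rw [hCdef, det_mul, det_mul]
    exact mul_ne_zero (mul_ne_zero hSu.ne_zero hBd.det_pos.ne') hSu.ne_zero
  obtain ⟨hRR, hRpsd, hRt⟩ := sqrt_spec hCpsd
  set R := CFC.sqrt C with hRdef
  have hRu : IsUnit R.det := isUnit_det_of_mul_self hRR hCdet
  -- `M = S⁻¹ R S⁻¹`, `M A M = B`
  set M := S⁻¹ * R * S⁻¹ with hMdef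
  have hMpsd : M.PosSemidef := by
    have h := hRpsd.conjTranspose_mul_mul_same S⁻¹
    rwa [conjTranspose_eq_transpose_of_trivial, hSit] at h
  have hMAM : M * Asum * M = Bsum := by
    calc M * Asum * M = S⁻¹ * R * (S⁻¹ * (S * S) * S⁻¹) * R * S⁻¹ := by
          rw [hSS, hMdef]; simp only [Matrix.mul_assoc]
      _ = S⁻¹ * (R * R) * S⁻¹ := by
          rw [show S⁻¹ * (S * S) * S⁻¹ = 1 by
            rw [← Matrix.mul_assoc, hSinv', Matrix.one_mul, hSinv]]
          simp only [Matrix.mul_assoc, Matrix.mul_one]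
      _ = S⁻¹ * (S * Bsum * S) * S⁻¹ := by rw [hRR]
      _ = Bsum := by
          rw [show S⁻¹ * (S * Bsum * S) * S⁻¹ = (S⁻¹ * S) * Bsum * (S * S⁻¹) by
            simp only [Matrix.mul_assoc], hSinv', hSinv, Matrix.one_mul, Matrix.mul_one]
  have hMdet : M.det ≠ 0 := by
    rw [hMdef, det_mul, det_mul]
    have hSi : S⁻¹.det ≠ 0 := (Matrix.isUnit_nonsing_inv_det S hSu).ne_zero
    exact mul_ne_zero (mul_ne_zero hSi hRu.ne_zero) hSi
  -- `N = M^{1/2}`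
  obtain ⟨hNN, hNpsd, hNt⟩ := sqrt_spec hMpsd
  set N := CFC.sqrt M with hNdef
  have hNu : IsUnit N.det := isUnit_det_of_mul_self hNN hMdet
  have hNinv : N * N⁻¹ = 1 := Matrix.mul_nonsing_inv N hNu
  have hNinv' : N⁻¹ * N = 1 := Matrix.nonsing_inv_mul N hNu
  have hNit : (N⁻¹)ᵀ = N⁻¹ := by rw [transpose_nonsing_inv, hNt]
  refine ⟨fun i => N * A i * N, fun j => N⁻¹ * B j * N⁻¹, fun i => ?_, fun j => ?_, fun i j => ?_, ?_⟩
  · have h := (hA i).conjTranspose_mul_mul_same Nᵀ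
    rwa [conjTranspose_eq_transpose_of_trivial, transpose_transpose, hNt] at h
  · have h := (hB j).conjTranspose_mul_mul_same (N⁻¹)ᵀ
    rwa [conjTranspose_eq_transpose_of_trivial, transpose_transpose, hNit] at h
  · calc (N * A i * N * (N⁻¹ * B j * N⁻¹)).trace = (N * (A i * (N * N⁻¹) * B j) * N⁻¹).trace := by
          simp only [Matrix.mul_assoc]
      _ = (N⁻¹ * N * (A i * (N * N⁻¹) * B j)).trace := by rw [Matrix.trace_mul_cycle]
      _ = (A i * B j).trace := by rw [hNinv', hNinv, Matrix.one_mul, Matrix.mul_one]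
  · -- `Σ N A_i N = N A N = N⁻¹ B N⁻¹ = Σ N⁻¹ B_j N⁻¹`
    rw [← Finset.sum_mul, ← Matrix.mul_sum, ← Finset.sum_mul, ← Matrix.mul_sum, ← hAsum, ← hBsum,
      ← hMAM, ← hNN]
    calc N * Asum * N = (N⁻¹ * N) * N * Asum * N * (N * N⁻¹) := by
          rw [hNinv', hNinv, Matrix.one_mul, Matrix.mul_one]
      _ = N⁻¹ * (N * N * Asum * (N * N)) * N⁻¹ := by simp only [Matrix.mul_assoc]

end Definite

/-! ### The general case -/

section General

variable {d : ℕ} {ι κ : Type*} [Fintype ι] [Fintype κ]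

/-- **Balanced psd factorizations, general case.** Real symmetric psd `A_i, B_j` of size `d` can be
replaced by psd `A'_i, B'_j` of some size `d' ≤ d` with the same inner products and `Σ A'_i = Σ B'_j`:
compress to the support of `Σ A_i`, then to the support of the compressed `Σ B_j`, and apply the
definite case. [cite: PrakashEtAl2017, §3.3.2 (p12)] -/
theorem exists_sum_eq (A : ι → Matrix (Fin d) (Fin d) ℝ) (B : κ → Matrix (Fin d) (Fin d) ℝ)
    (hA : ∀ i, (A i).PosSemidef) (hB : ∀ j, (B j).PosSemidef) :
    ∃ (d' : ℕ) (A' : ι → Matrix (Fin d') (Fin d') ℝ) (B' : κ → Matrix (Fin d') (Fin d') ℝ),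
      d' ≤ d ∧ (∀ i, (A' i).PosSemidef) ∧ (∀ j, (B' j).PosSemidef) ∧
      (∀ i j, (A' i * B' j).trace = (A i * B j).trace) ∧ ∑ i, A' i = ∑ j, B' j := by
  -- first compression: `Σ A` becomes definite
  obtain ⟨m₁, A₁, B₁, hm₁, hA₁, hB₁, htr₁, hA₁d, -⟩ := compress_step A B hA hB
  -- second compression, with the roles of `A` and `B` exchanged: `Σ B` becomes definite too
  obtain ⟨m₂, B₂, A₂, hm₂, hB₂, hA₂, htr₂, hB₂d, hA₂d⟩ := compress_step B₁ A₁ hB₁ hA₁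
  have hA₂d' := hA₂d hA₁d
  obtain ⟨A₃, B₃, hA₃, hB₃, htr₃, hsum⟩ := exists_sum_eq_of_posDef A₂ B₂ hA₂ hB₂ hA₂d' hB₂d
  refine ⟨m₂, A₃, B₃, hm₂.trans hm₁, hA₃, hB₃, fun i j => ?_, hsum⟩
  rw [htr₃, ← htr₁ i j, ← Matrix.trace_mul_comm (B₁ j), ← htr₂ j i, Matrix.trace_mul_comm]

end General

end PsdSumNormalForm

/-! ### The printed corollary for psd factorizations -/

open Literature.Analysis.Convex (padMatrix padMatrix_apply posSemidef_padMatrix selMatrix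
  selMatrix_transpose_mul_self)

/-- `Tr(P X Pᵀ · P Y Pᵀ) = Tr(X Y)` for the selection matrix `P` of an injective map. [folklore] -/
private theorem trace_padMatrix_mul_padMatrix' {m m' : ℕ} {e : Fin m → Fin m'}
    (he : Function.Injective e) (X Y : Matrix (Fin m) (Fin m) ℝ) :
    (padMatrix e X * padMatrix e Y).trace = (X * Y).trace := by
  rw [padMatrix_apply, padMatrix_apply]
  calc (selMatrix e * X * (selMatrix e)ᵀ * (selMatrix e * Y * (selMatrix e)ᵀ)).trace
      = (selMatrix e * (X * ((selMatrix e)ᵀ * selMatrix e) * Y) * (selMatrix e)ᵀ).trace := by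
        simp only [Matrix.mul_assoc]
    _ = ((selMatrix e)ᵀ * selMatrix e * (X * ((selMatrix e)ᵀ * selMatrix e) * Y)).trace := by
        rw [Matrix.trace_mul_cycle]
    _ = (X * Y).trace := by
        rw [selMatrix_transpose_mul_self he, Matrix.one_mul, Matrix.mul_one]

/-- **PSVW §3.3.2, the normal form `Σ_i A_i = Σ_j B_j`** (p12, verbatim): "As a corollary we also get
that in any psd-factorization of `X` we may assume that the psd factors satisfy
`Σ_{i=1}^n A_i = Σ_{j=1}^m B_j`." Typed for the psd factorizations of this directory (real symmetric
psd factors, `HasPsdFactorization`): a matrix with a psd factorization of size `k` has a psd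
factorization OF THE SAME SIZE `k` whose factors satisfy `Σ_i A_i = Σ_j B_j`. PROVED (by the
geometric-mean argument of `PsdSumNormalForm.exists_sum_eq`, then zero-padding back to size `k`; the
printed route is via [JSWZ] and Theorem 1). [cite: PrakashEtAl2017, §3.3.2 (p12)] -/
theorem HasPsdFactorization.exists_sum_eq {ι κ : Type*} [Fintype ι] [Fintype κ] {M : ι → κ → ℝ}
    {k : ℕ} (h : HasPsdFactorization M k) :
    ∃ (A : ι → Matrix (Fin k) (Fin k) ℝ) (B : κ → Matrix (Fin k) (Fin k) ℝ),
      (∀ i, (A i).PosSemidef) ∧ (∀ j, (B j).PosSemidef) ∧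
      (∀ i j, M i j = (A i * B j).trace) ∧ ∑ i, A i = ∑ j, B j := by
  obtain ⟨A, B, hA, hB, hM⟩ := h
  obtain ⟨d', A', B', hd', hA', hB', htr, hsum⟩ := PsdSumNormalForm.exists_sum_eq A B hA hB
  have hinj : Function.Injective (Fin.castLE hd') := Fin.castLE_injective hd'
  refine ⟨fun i => padMatrix (Fin.castLE hd') (A' i), fun j => padMatrix (Fin.castLE hd') (B' j),
    fun i => posSemidef_padMatrix (hA' i), fun j => posSemidef_padMatrix (hB' j), fun i j => ?_, ?_⟩
  · rw [trace_padMatrix_mul_padMatrix' hinj, htr, hM]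
  · rw [← map_sum, ← map_sum, hsum]

/-- The same normal form stated through `HasPsdFactorization`: nothing changes about the size
(`rank_psd` may be computed over balanced factorizations only). [cite: PrakashEtAl2017, §3.3.2 (p12)] -/
theorem hasPsdFactorization_iff_exists_sum_eq {ι κ : Type*} [Fintype ι] [Fintype κ] {M : ι → κ → ℝ}
    {k : ℕ} :
    HasPsdFactorization M k ↔
      ∃ (A : ι → Matrix (Fin k) (Fin k) ℝ) (B : κ → Matrix (Fin k) (Fin k) ℝ),
        (∀ i, (A i).PosSemidef) ∧ (∀ j, (B j).PosSemidef) ∧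
        (∀ i j, M i j = (A i * B j).trace) ∧ ∑ i, A i = ∑ j, B j :=
  ⟨fun h => h.exists_sum_eq, fun ⟨A, B, hA, hB, hM, _⟩ => ⟨A, B, hA, hB, hM⟩⟩

end Literature.Combinatorics.Optimization
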